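import Literature.Computability.Complexity.OccurrenceObstructionsIPExtension
import HarnessLib

/-!
# Ikenmeyer–Panova 2017, §4: the pieces of the proof of Thm. 4.6 — shapes by their rows below the
# first, stacking pieces side by side, and the hook families of Cor. 4.5 in every large frame

Sibling proofs file (D-0014) of `Literature/Computability/Complexity/OccurrenceObstructionsIP.lean`
(conventions as there: `a × b` = `Nat.Partition.rectangle a b` = `a` rows of length `b`; `ν(N)` =
the partition of `N` whose rows below the first are those of `ν`; everything over `ℂ`). Theorems
only; no definition, no statement of the tree is changed and no named fact is introduced.

Source: C. Ikenmeyer, G. Panova, Adv. Math. 319 (2017) 40–66 = arXiv:1512.03798 (held), §4: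
Cor. 4.5 (held: Cor. 22) and the proof of Thm. 4.6 (held: Thm. 23, pp. 11–12: the five summands
are realised in frames `a × wᵢ` and added with the semigroup property).

## What is proved

* §1 Shapes through their rows below the first: `exists_partition_of_rows` (a shape `ν(N)` with
  prescribed weakly decreasing rows exists as soon as `N ≥ |ν| + ν₁`), and the rows of a union of
  columns (`(J.filter (r+1 ≤ ·)).card`, as in `exists_colUnion_pos`): `exists_partition_of_cols`.
* §2 **Stacking** (the semigroup property in frames with a common number of rows,
  `exists_rowSum_pos`): pieces `νᵢ(h sᵢ)` positive against `h × sᵢ` give `(Σ νᵢ)(h Σ sᵢ)` positive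
  against `h × Σ sᵢ` (IP, proof of Thm. 4.6: "Using the semigroup property on equations (I)–(V) we
  obtain `g(ν(aM), a × M, a × M) > 0` where `M = …`"), and growth of the frame in both directions in
  existence form (`exists_pos_of_frame_le`, `exists_pos_of_frame_le'`).
* §3 **Cor. 4.5 beyond the computed range, from its computed base, column form**
  (`ikenmeyerPanova2017_cor_4_5_fam1/11/1111/111111/21`): for each `η ∈ 𝔛 ∖ {(3,1)} =
  {(1), (1,1), (1⁴), (1⁶), (2,1)}` — the five `ρ` of the printed proof — the positivity against
  `c × c` of a new first row over the columns `η ∪ {j}`, for all `c ≥ 7` and all legs `j` in the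
  printed range, from the printed base case `h = w = 7` taken as a hypothesis (IP: "we can apply
  Proposition 4.3 with initial condition `a = 7`, which is verified computationally" — Kronecker
  coefficients of `S₄₉`, not available in the tree), by the proved Prop. 4.3.
* §4 Single pieces against `w × w`: a good column (`exists_hook_pos_sq`, Cor. 4.4 proved in the
  tree), and transport from the computed frame `7 × 7` (`exists_pos_sq_of_seven`).
* §5 **Splitting into atoms** (`exists_atom_decomposition`, the combinatorics of Lemma 4.1 in the
  form used here): every nonempty multiset of column lengths other than the six column multisets of
  `𝔛` is a disjoint union of at most as many "atoms" — single good columns, pairs/triples of bad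
  columns, `{1,1,1,2}, {1,2,2,2}, {1⁴,2}, {3,4}, {3,6}, {5,6}`, and the hook families of Cor. 4.5 —
  stated for an arbitrary property `R` of multisets enjoyed by the atoms.
* §6 **The columns of a shape** (`exists_cols_of_shape`): the multiset `C` of column lengths of
  the body `λ̄` (IP's `c_k`), with rows `#{c ∈ C : c > r} = λ_{r+2}`, `Σ C = |λ̄|`,
  `|C| = λ₂ ≤ |λ̄|`, lengths in `[1, ℓ(λ̄)]`, and `λ̄ ∉ 𝔛 ⇒ C ∉ 𝔛` (column form); with
  `body_eq_coe_tail` (`λ̄ = (λ₂, λ₃, …)`).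
* §7 **Stacks** (`exists_stack_pos`, `exists_stacks_pos`): pieces realised against `w × w` packed
  `p ≤ a/w` to a stack against `a × w`, and all stacks side by side against `a × w⌈n/p⌉`.

## References

* C. Ikenmeyer, G. Panova, Adv. Math. 319 (2017) 40–66 = arXiv:1512.03798, §4: Prop. 4.3,
  Cor. 4.5 (i)–(iv) and "for all other ρ", Thm. 4.6 (proof). [key `IkenmeyerPanova2017`]

## Mathlib and tree

Mathlib: `Nat.Partition`, `Multiset.filter`/`card`/`count`/`sum_sum`, `Multiset.le_iff_exists_add`,
`Multiset.le_count_iff_replicate_le`, `Multiset.eq_of_le_of_card_le`, `List.sum`, `List.take`/`drop`,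
`Finset.sum_range_succ'`, `Nat.strong_induction_on`, `decide`. Tree: `sum_Ioc_sub_eq`,
`body`, `bodySize`, `mem_ipExceptionalBodies_iff`, `card_body`, `sup_parts_eq_getD_sortedParts`,
`partitionOfRows`, `getD_sortedParts_partitionOfRows`, `getD_sortedParts_rowAdd`,
`rowAdd_rectangle_parts`, `kroneckerCoeff_congr_parts`, `kroneckerCoeff_pos_of_eq_zero`,
`ikenmeyerPanova2017_semigroup_holds` (`OccurrenceObstructionsIP*`); `kroneckerCoeff_pos_of_frame_le`/`'`
(`…IPHookPositivity`); `getD_colAdd`, `ikenmeyerPanova2017_prop_4_3` (`…IPExtension`).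
-/

noncomputable section

open scoped BigOperators

namespace Literature.Computability.Complexity

open Literature.NumberTheory.DiophantineGeometry (kroneckerCoeff getD_sortedParts_transpose
  getD_sortedParts_indiscrete_transpose sortedParts_indiscrete)

/-! ### §1 Shapes through their rows below the first -/

section Rows

/-- **A shape with prescribed rows below the first exists**: for weakly decreasing `f` vanishing
from `L` on and `N ≥ Σ f + f 0`, there is a partition of `N` whose rows below the first are `f`.
[folklore] -/
theorem exists_partition_of_rows (f : ℕ → ℕ) (hf : Antitone f) {L : ℕ} (hL : ∀ r, L ≤ r → f r = 0)
    {N : ℕ} (hN : ∑ r ∈ Finset.range L, f r + f 0 ≤ N) :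
    ∃ lam : Nat.Partition N, ∀ r, lam.sortedParts.getD (r + 1) 0 = f r := by
  set w : ℕ → ℕ := fun r => if r = 0 then N - ∑ r ∈ Finset.range L, f r else f (r - 1) with hw
  have hanti : Antitone w := by
    intro i j hij
    simp only [hw]
    by_cases hj : j = 0
    · subst hj
      have hi : i = 0 := by omega
      subst hi; exact le_rfl
    rw [if_neg hj]
    by_cases hi : i = 0
    · rw [if_pos hi]
      exact (hf (Nat.zero_le (j - 1))).trans (by omega)
    · rw [if_neg hi]
      exact hf (by omega)
  have hsum : ∑ r ∈ Finset.range (L + 1), w r = N := by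
    rw [Finset.sum_range_succ']
    simp only [hw, Nat.succ_ne_zero, if_false, Nat.add_sub_cancel, if_true]
    omega
  refine ⟨partitionOfRows w (L + 1) N, fun r => ?_⟩
  rw [getD_sortedParts_partitionOfRows hanti hsum]
  simp only [hw, Nat.succ_ne_zero, if_false, Nat.add_sub_cancel]
  split_ifs with h
  · rfl
  · exact (hL r (by omega)).symm

/-- The rows of a union of columns of lengths `J`: row `r` below the first has `#{j ∈ J : j > r}`
boxes; these are weakly decreasing in `r`. [folklore] -/
theorem colRows_antitone (J : Multiset ℕ) : Antitone fun r => (J.filter (r + 1 ≤ ·)).card := by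
  intro i j hij
  exact Multiset.card_le_card (Multiset.monotone_filter_right J fun x hx => by omega)

/-- Beyond the longest column the union of columns has no rows. [folklore] -/
theorem colRows_eq_zero (J : Multiset ℕ) {L r : ℕ} (hJ : ∀ j ∈ J, j ≤ L) (hr : L ≤ r) :
    (J.filter (r + 1 ≤ ·)).card = 0 := by
  rw [Multiset.card_eq_zero, Multiset.filter_eq_nil]
  intro j hj h
  have := hJ j hj
  omega

/-- The first row below the top of a union of columns of positive lengths counts the columns.
[folklore] -/
theorem colRows_zero (J : Multiset ℕ) (hJ : ∀ j ∈ J, 1 ≤ j) : (J.filter (0 + 1 ≤ ·)).card = J.card := by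
  rw [Multiset.filter_eq_self.2 fun j hj => by simpa using hJ j hj]

/-- The rows of a union of columns sum to the total length of the columns:
`Σ_r #{j ∈ J : j > r} = Σ J`. [folklore] -/
theorem sum_colRows (J : Multiset ℕ) {L : ℕ} (hJ : ∀ j ∈ J, j ≤ L) :
    ∑ r ∈ Finset.range L, (J.filter (r + 1 ≤ ·)).card = J.sum := by
  induction J using Multiset.induction_on with
  | empty => simp
  | cons j J ih =>
    have hj : j ≤ L := hJ j (Multiset.mem_cons_self j J)
    simp only [card_filter_le_cons, Finset.sum_add_distrib, Multiset.sum_cons]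
    rw [ih fun j' hj' => hJ j' (Multiset.mem_cons_of_mem hj')]
    congr 1
    rw [Finset.sum_ite, Finset.sum_const_zero, add_zero, Finset.sum_const, smul_eq_mul, mul_one]
    have : (Finset.range L).filter (fun r => r + 1 ≤ j) = Finset.range j := by
      ext r; simp only [Finset.mem_filter, Finset.mem_range]; omega
    rw [this, Finset.card_range]

/-- **A union of columns with a new first row exists in every large frame**: for column lengths
`J ≤ L` (all positive) and `N ≥ Σ J + |J|`, there is a partition of `N` whose rows below the first
are those of the union of the columns `J`. [folklore] -/
theorem exists_partition_of_cols (J : Multiset ℕ) {L : ℕ} (hJ : ∀ j ∈ J, 1 ≤ j ∧ j ≤ L) {N : ℕ}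
    (hN : J.sum + J.card ≤ N) :
    ∃ lam : Nat.Partition N, ∀ r, lam.sortedParts.getD (r + 1) 0 = (J.filter (r + 1 ≤ ·)).card := by
  refine exists_partition_of_rows _ (colRows_antitone J) (L := L)
    (fun r hr => colRows_eq_zero J (fun j hj => (hJ j hj).2) hr) ?_
  rw [sum_colRows J fun j hj => (hJ j hj).2, colRows_zero J fun j hj => (hJ j hj).1]
  exact hN

end Rows

/-! ### §2 Stacking pieces side by side (the semigroup property in frames `h × sᵢ`) -/

section Stacking

/-- **Stacking**: if each piece `(fᵢ, sᵢ)` of a list is realised — a partition of `h sᵢ` with rows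
`fᵢ` below the first and positive Kronecker coefficient against `h × sᵢ` — then the row-wise sum is
realised against `h × Σ sᵢ` (rows `Σ fᵢ` below the first). IP, proof of Thm. 4.6: the summands
(I)–(V) live in frames `a × wᵢ` and "using the semigroup property … we obtain
`g(ν(aM), a × M, a × M) > 0`, where `M = Σ wᵢ`". [cite: IkenmeyerPanova2017, Thm. 4.6 (proof, the assembly of (I)–(V); held: Thm. 23, p. 12)] -/
theorem exists_rowSum_pos (h : ℕ) :
    ∀ P : List ((ℕ → ℕ) × ℕ),
      (∀ p ∈ P, ∃ mu : Nat.Partition (h * p.2),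
        (∀ r, mu.sortedParts.getD (r + 1) 0 = p.1 r) ∧
          0 < kroneckerCoeff ℂ mu (Nat.Partition.rectangle h p.2) (Nat.Partition.rectangle h p.2)) →
      ∃ mu : Nat.Partition (h * (P.map Prod.snd).sum),
        (∀ r, mu.sortedParts.getD (r + 1) 0 = (P.map fun p => p.1 r).sum) ∧
          0 < kroneckerCoeff ℂ mu (Nat.Partition.rectangle h (P.map Prod.snd).sum)
            (Nat.Partition.rectangle h (P.map Prod.snd).sum)
  | [] => fun _ => by
    refine ⟨⟨0, fun h => by simp at h, by simp⟩, fun r => ?_, kroneckerCoeff_pos_of_eq_zero (by simp) _ _ _⟩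
    simp [Nat.Partition.sortedParts]
  | p :: P => fun hP => by
    obtain ⟨mu, hmu, hpos⟩ := hP p (List.mem_cons_self)
    obtain ⟨mu', hmu', hpos'⟩ := exists_rowSum_pos h P fun q hq => hP q (List.mem_cons_of_mem p hq)
    have hsg := ikenmeyerPanova2017_semigroup_holds _ _ _ _ _ _ hpos hpos'
    have e : h * p.2 + h * (P.map Prod.snd).sum = h * ((p :: P).map Prod.snd).sum := by
      rw [List.map_cons, List.sum_cons, Nat.mul_add]
    let nu : Nat.Partition (h * ((p :: P).map Prod.snd).sum) :=
      ⟨(mu.rowAdd mu').parts, (mu.rowAdd mu').parts_pos, by rw [(mu.rowAdd mu').parts_sum, e]⟩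
    have hR : ((Nat.Partition.rectangle h p.2).rowAdd
        (Nat.Partition.rectangle h (P.map Prod.snd).sum)).parts =
        (Nat.Partition.rectangle h ((p :: P).map Prod.snd).sum).parts := by
      rw [rowAdd_rectangle_parts, List.map_cons, List.sum_cons]
    refine ⟨nu, fun r => ?_, ?_⟩
    · change (mu.rowAdd mu').sortedParts.getD (r + 1) 0 = _
      rw [getD_sortedParts_rowAdd, hmu r, hmu' r, List.map_cons, List.sum_cons]
    · rwa [kroneckerCoeff_congr_parts e (lam' := nu)
        (mu' := Nat.Partition.rectangle h ((p :: P).map Prod.snd).sum)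
        (nu' := Nat.Partition.rectangle h ((p :: P).map Prod.snd).sum) rfl hR hR] at hsg

/-- **Growing the frame, existence form**: a piece realised against `c × d` is realised against
every `a × b` with `a ≥ c`, `b ≥ d` (add one-row triples; `kroneckerCoeff_pos_of_frame_le`), the
shape `ν(ab)` existing as soon as it did for `cd`. [cite: IkenmeyerPanova2017, Thm. 4.6 (proof, "Since a ≥ wℓ̄ we have …"; held: Thm. 23, p. 12)] -/
theorem exists_pos_of_frame_le {c d a b : ℕ} {f : ℕ → ℕ}
    (h : ∃ mu : Nat.Partition (c * d), (∀ r, mu.sortedParts.getD (r + 1) 0 = f r) ∧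
      0 < kroneckerCoeff ℂ mu (Nat.Partition.rectangle c d) (Nat.Partition.rectangle c d))
    (hca : c ≤ a) (hdb : d ≤ b) :
    ∃ lam : Nat.Partition (a * b), (∀ r, lam.sortedParts.getD (r + 1) 0 = f r) ∧
      0 < kroneckerCoeff ℂ lam (Nat.Partition.rectangle a b) (Nat.Partition.rectangle a b) := by
  obtain ⟨mu, hmu, hpos⟩ := h
  -- the shape in the larger frame: same rows below the first
  have hcard : mu.parts.card ≤ c * d + 1 := (mu.card_parts_le_size).trans (Nat.le_succ _)
  have hzero : ∀ r, c * d ≤ r → f r = 0 := fun r hr => by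
    rw [← hmu r]; exact getD_sortedParts_eq_zero mu (by omega)
  have hsum := sum_range_getD_sortedParts_of_le mu hcard
  rw [Finset.sum_range_succ'] at hsum
  simp only [hmu] at hsum
  have hf0 : f 0 ≤ mu.sortedParts.getD 0 0 := by
    rw [← hmu 0]; exact antitone_getD_sortedParts mu (Nat.zero_le 1)
  obtain ⟨lam, hlam⟩ := exists_partition_of_rows f
    (fun i j hij => by rw [← hmu i, ← hmu j]; exact antitone_getD_sortedParts mu (by omega))
    hzero (N := a * b) (by nlinarith [Nat.mul_le_mul hca hdb])
  exact ⟨lam, hlam, kroneckerCoeff_pos_of_frame_le mu hpos hca hdb lam fun r => by rw [hlam r, hmu r]⟩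

/-- **Growing the transposed frame, existence form**: a piece realised against `c × d` is realised
against every `a × b` with `a ≥ d`, `b ≥ c` (transpose the rectangles first).
[cite: IkenmeyerPanova2017, Thm. 4.6 (proof, "and hence by transposition …"; held: Thm. 23, p. 11)] -/
theorem exists_pos_of_frame_le' {c d a b : ℕ} {f : ℕ → ℕ}
    (h : ∃ mu : Nat.Partition (c * d), (∀ r, mu.sortedParts.getD (r + 1) 0 = f r) ∧
      0 < kroneckerCoeff ℂ mu (Nat.Partition.rectangle c d) (Nat.Partition.rectangle c d))
    (hda : d ≤ a) (hcb : c ≤ b) :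
    ∃ lam : Nat.Partition (a * b), (∀ r, lam.sortedParts.getD (r + 1) 0 = f r) ∧
      0 < kroneckerCoeff ℂ lam (Nat.Partition.rectangle a b) (Nat.Partition.rectangle a b) := by
  obtain ⟨mu, hmu, hpos⟩ := h
  let mu' : Nat.Partition (d * c) := ⟨mu.parts, mu.parts_pos, by rw [mu.parts_sum, mul_comm]⟩
  have hpos' : 0 < kroneckerCoeff ℂ mu' (Nat.Partition.rectangle d c)
      (Nat.Partition.rectangle d c) := by
    rwa [kroneckerCoeff_rectangle_transpose mu mu' rfl] at hpos
  have hsp : mu'.sortedParts = mu.sortedParts := sortedParts_congr_parts rfl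
  exact exists_pos_of_frame_le ⟨mu', fun r => by rw [hsp, hmu r], hpos'⟩ hda hcb

end Stacking

/-! ### §3 The five hook families of Cor. 4.5 in every frame `c × c`, `c ≥ 7` (column form) -/

section Families

/-- The column `(1^j)` has `j` parts. [folklore] -/
theorem card_parts_indiscrete_transpose (j : ℕ) :
    (Nat.Partition.indiscrete j).transpose.parts.card = j := by
  rw [card_parts_transpose_eq, getD_sortedParts_indiscrete, if_pos rfl]

/-- The first row of the column `(1^j)`, `j ≥ 1`, is `1`. [folklore] -/
theorem getD_zero_indiscrete_transpose {j : ℕ} (hj : 1 ≤ j) :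
    (Nat.Partition.indiscrete j).transpose.sortedParts.getD 0 0 = 1 := by
  rw [getD_sortedParts_indiscrete_transpose, if_pos (by omega)]

/-- The one-box partition `(1)` has one part. [folklore] -/
theorem card_parts_indiscrete_one : (Nat.Partition.indiscrete 1).parts.card = 1 := by
  rw [Nat.Partition.indiscrete_parts one_ne_zero, Multiset.card_singleton]

/-- The number of parts is read off the rows: if the nonempty rows are exactly the rows `r < L`
then `ℓ(λ) = L`. [folklore] -/
theorem card_parts_eq_of_rows {N : ℕ} (μ : Nat.Partition N) {L : ℕ}
    (h : ∀ r, 0 < μ.sortedParts.getD r 0 ↔ r < L) : μ.parts.card = L := by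
  have key : ∀ r, r < μ.parts.card ↔ r < L := fun r =>
    (getD_sortedParts_pos_iff μ r).symm.trans (h r)
  refine le_antisymm (not_lt.1 fun hlt => ?_) (not_lt.1 fun hlt => ?_)
  · exact lt_irrefl _ ((key _).1 hlt)
  · exact lt_irrefl _ ((key _).2 hlt)

/-- The rows of `(2,1) = (1,1) + (1)`: `2, 1, 0, …`. [folklore] -/
theorem getD_twoOne (r : ℕ) :
    ((Nat.Partition.indiscrete 2).transpose.rowAdd (Nat.Partition.indiscrete 1)).sortedParts.getD
      r 0 = if r = 0 then 2 else if r = 1 then 1 else 0 := by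
  rw [getD_sortedParts_rowAdd, getD_sortedParts_indiscrete_transpose, getD_sortedParts_indiscrete]
  split_ifs <;> omega

/-- `(2,1)` has two parts. [folklore] -/
theorem card_parts_twoOne :
    ((Nat.Partition.indiscrete 2).transpose.rowAdd (Nat.Partition.indiscrete 1)).parts.card = 2 :=
  card_parts_eq_of_rows _ fun r => by rw [getD_twoOne]; split_ifs <;> omega

/-- The rows of the union of two columns of lengths `i` and `j`: `[r < j] + [r < i]`. [folklore] -/
theorem colRows_pair (i j r : ℕ) :
    (({i, j} : Multiset ℕ).filter (r + 1 ≤ ·)).card =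
      (if r < j then 1 else 0) + if r < i then 1 else 0 := by
  rw [Multiset.insert_eq_cons, card_filter_le_cons, ← Multiset.cons_zero j, card_filter_le_cons,
    Multiset.filter_zero, Multiset.card_zero, add_zero]
  split_ifs <;> omega

/-- The rows of the union of three columns of lengths `1`, `2` and `j`: `[r < j] + (2,1)_r`.
[folklore] -/
theorem colRows_oneTwo (j r : ℕ) :
    (({1, 2, j} : Multiset ℕ).filter (r + 1 ≤ ·)).card =
      (if r < j then 1 else 0) + if r = 0 then 2 else if r = 1 then 1 else 0 := by
  rw [Multiset.insert_eq_cons, card_filter_le_cons, Multiset.insert_eq_cons, card_filter_le_cons,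
    ← Multiset.cons_zero j, card_filter_le_cons, Multiset.filter_zero, Multiset.card_zero, add_zero]
  split_ifs <;> omega

/-- The rows of `(1^j) + (1^i)` are those of the union of the columns `i`, `j`. [folklore] -/
theorem getD_colAdd_indiscrete_transpose (i j r : ℕ) :
    ((Nat.Partition.indiscrete j).transpose.rowAdd
      (Nat.Partition.indiscrete i).transpose).sortedParts.getD r 0 =
      (({i, j} : Multiset ℕ).filter (r + 1 ≤ ·)).card := by
  rw [getD_colAdd, getD_sortedParts_indiscrete_transpose, colRows_pair]

/-- The rows of `(1^j) + (1)` are those of the union of the columns `1`, `j`. [folklore] -/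
theorem getD_colAdd_indiscrete_one (j r : ℕ) :
    ((Nat.Partition.indiscrete j).transpose.rowAdd (Nat.Partition.indiscrete 1)).sortedParts.getD
      r 0 = (({1, j} : Multiset ℕ).filter (r + 1 ≤ ·)).card := by
  rw [getD_colAdd, getD_sortedParts_indiscrete, colRows_pair]
  split_ifs <;> omega

/-- The rows of `(1^j) + (2,1)` are those of the union of the columns `1`, `2`, `j`. [folklore] -/
theorem getD_colAdd_twoOne (j r : ℕ) :
    ((Nat.Partition.indiscrete j).transpose.rowAdd ((Nat.Partition.indiscrete 2).transpose.rowAdd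
      (Nat.Partition.indiscrete 1))).sortedParts.getD r 0 =
      (({1, 2, j} : Multiset ℕ).filter (r + 1 ≤ ·)).card := by
  rw [getD_colAdd, getD_twoOne, colRows_oneTwo]

/-- **IP Cor. 4.5 (i), `ρ = (1)`, in every square frame from its computed base** (held: Cor. 22
(i): "When `ρ = (1)` then `R_ρ = 3`, `H¹_ρ = {2}` and `H²_ρ = {4}`, we obtain
`g((h² - 1 - j, 2, 1^{j-1}), h × h, h × h) > 0` for `j ∈ [1, h² - R_ρ] ∖ {2, h² - 4}`"): granted
the base `h = 7` ("verified computationally": `hbase`, legs `j ∈ [1, 46] ∖ {2, 45}` against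
`7 × 7` — Kronecker coefficients of `S₄₉`), the proved Prop. 4.3 gives every `c ≥ 7` and
`j ∈ [1, c² - 3] ∖ {2, c² - 4}`. The shape `(1^j + (1))(c²) = (c² - j - 1, 2, 1^{j-1})` is
described by its rows below the first: those of the union of two columns of lengths `1` and `j`.
[cite: IkenmeyerPanova2017, Cor. 4.5 (i) (held: Cor. 22 (i), p. 11)] -/
theorem ikenmeyerPanova2017_cor_4_5_fam1
    (hbase : ∀ j, 1 ≤ j → j ≤ 46 → j ≠ 2 → j ≠ 45 → ∀ lam : Nat.Partition (7 * 7),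
      (∀ r, lam.sortedParts.getD (r + 1) 0 = (({1, j} : Multiset ℕ).filter (r + 1 ≤ ·)).card) →
      0 < kroneckerCoeff ℂ lam (Nat.Partition.rectangle 7 7) (Nat.Partition.rectangle 7 7))
    {c : ℕ} (hc : 7 ≤ c) {j : ℕ} (hj : 1 ≤ j) (hjR : j + 3 ≤ c * c) (hj2 : j ≠ 2)
    (hj4 : c * c - j ≠ 4) (lam : Nat.Partition (c * c))
    (hlam : ∀ r, lam.sortedParts.getD (r + 1) 0 =
      (({1, j} : Multiset ℕ).filter (r + 1 ≤ ·)).card) :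
    0 < kroneckerCoeff ℂ lam (Nat.Partition.rectangle c c) (Nat.Partition.rectangle c c) := by
  have hcard := card_parts_indiscrete_one
  have h0 : (Nat.Partition.indiscrete 1).sortedParts.getD 0 0 = 1 := by
    rw [getD_sortedParts_indiscrete, if_pos rfl]
  refine ikenmeyerPanova2017_prop_4_3 (Nat.Partition.indiscrete 1) {2} {4} (a := 7) (b := c) (k := j) le_rfl
    (by rw [hcard, h0]; norm_num) (by rw [hcard]; norm_num) (by simp) (by simp) ?_ hc
    (by rw [hcard]; exact hj) (by rw [h0]; omega) (by simpa using hj2)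
    (by simpa using hj4) lam
    (fun r => by rw [hlam r, getD_colAdd_indiscrete_one])
  intro k hk hkR hk1 hk2 mu hmu
  rw [hcard] at hk
  rw [h0] at hkR
  exact hbase k hk (by omega) (by simpa using hk1) (fun h45 => hk2 (by simp [h45])) mu
    fun r => by rw [hmu r, getD_colAdd_indiscrete_one]

/-- **IP Cor. 4.5 (iii), `ρ = (1,1)`, in every square frame from its computed base** (held:
Cor. 22 (iii): "`R_ρ = 4`, `H¹_ρ = ∅` and `H²_ρ = {5}`", legs `j ≥ ℓ(ρ) = 2`): granted the base
`h = 7` (`hbase`: `j ∈ [2, 45] ∖ {44}` against `7 × 7`), every `c ≥ 7` and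
`j ∈ [2, c² - 4] ∖ {c² - 5}`; shapes `(c² - j - 2, 2, 2, 1^{j-2})` = a new first row over the
columns `2`, `j`. [cite: IkenmeyerPanova2017, Cor. 4.5 (iii) (held: Cor. 22 (iii), p. 11)] -/
theorem ikenmeyerPanova2017_cor_4_5_fam11
    (hbase : ∀ j, 2 ≤ j → j ≤ 45 → j ≠ 44 → ∀ lam : Nat.Partition (7 * 7),
      (∀ r, lam.sortedParts.getD (r + 1) 0 = (({2, j} : Multiset ℕ).filter (r + 1 ≤ ·)).card) →
      0 < kroneckerCoeff ℂ lam (Nat.Partition.rectangle 7 7) (Nat.Partition.rectangle 7 7))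
    {c : ℕ} (hc : 7 ≤ c) {j : ℕ} (hj : 2 ≤ j) (hjR : j + 4 ≤ c * c) (hj5 : c * c - j ≠ 5)
    (lam : Nat.Partition (c * c))
    (hlam : ∀ r, lam.sortedParts.getD (r + 1) 0 =
      (({2, j} : Multiset ℕ).filter (r + 1 ≤ ·)).card) :
    0 < kroneckerCoeff ℂ lam (Nat.Partition.rectangle c c) (Nat.Partition.rectangle c c) := by
  have hcard := card_parts_indiscrete_transpose 2
  have h0 := getD_zero_indiscrete_transpose (j := 2) (by norm_num)
  refine ikenmeyerPanova2017_prop_4_3 (Nat.Partition.indiscrete 2).transpose ∅ {5} (a := 7) (b := c) (k := j) le_rfl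
    (by rw [hcard, h0]; norm_num) (by rw [hcard]; norm_num) (by simp) (by simp) ?_ hc
    (by rw [hcard]; exact hj) (by rw [h0]; omega) (by simp) (by simpa using hj5) lam
    (fun r => by rw [hlam r, getD_colAdd_indiscrete_transpose])
  intro k hk hkR _ hk2 mu hmu
  rw [hcard] at hk
  rw [h0] at hkR
  exact hbase k hk (by omega) (fun h44 => hk2 (by simp [h44])) mu
    fun r => by rw [hmu r, getD_colAdd_indiscrete_transpose]

/-- **IP Cor. 4.5, `ρ = (1⁴)`, in every square frame from its computed base** (held: Cor. 22,
"For all other `ρ` with `j ≥ ℓ(ρ)`, set `H¹_ρ = H²_ρ = ∅` and `R_ρ = |ρ| + ρ₁ + 1`" (= 6)):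
granted the base `h = 7` (`hbase`: `j ∈ [4, 43]` against `7 × 7`), every `c ≥ 7` and
`j ∈ [4, c² - 6]`; shapes = a new first row over the columns `4`, `j`.
[cite: IkenmeyerPanova2017, Cor. 4.5 (held: Cor. 22, "for all other ρ", p. 11)] -/
theorem ikenmeyerPanova2017_cor_4_5_fam1111
    (hbase : ∀ j, 4 ≤ j → j ≤ 43 → ∀ lam : Nat.Partition (7 * 7),
      (∀ r, lam.sortedParts.getD (r + 1) 0 = (({4, j} : Multiset ℕ).filter (r + 1 ≤ ·)).card) →
      0 < kroneckerCoeff ℂ lam (Nat.Partition.rectangle 7 7) (Nat.Partition.rectangle 7 7))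
    {c : ℕ} (hc : 7 ≤ c) {j : ℕ} (hj : 4 ≤ j) (hjR : j + 6 ≤ c * c) (lam : Nat.Partition (c * c))
    (hlam : ∀ r, lam.sortedParts.getD (r + 1) 0 =
      (({4, j} : Multiset ℕ).filter (r + 1 ≤ ·)).card) :
    0 < kroneckerCoeff ℂ lam (Nat.Partition.rectangle c c) (Nat.Partition.rectangle c c) := by
  have hcard := card_parts_indiscrete_transpose 4
  have h0 := getD_zero_indiscrete_transpose (j := 4) (by norm_num)
  refine ikenmeyerPanova2017_prop_4_3 (Nat.Partition.indiscrete 4).transpose ∅ ∅ (a := 7) (b := c) (k := j) le_rfl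
    (by rw [hcard, h0]; norm_num) (by rw [hcard]; norm_num) (by simp) (by simp) ?_ hc
    (by rw [hcard]; exact hj) (by rw [h0]; omega) (by simp) (by simp) lam
    (fun r => by rw [hlam r, getD_colAdd_indiscrete_transpose])
  intro k hk hkR _ _ mu hmu
  rw [hcard] at hk
  rw [h0] at hkR
  exact hbase k hk (by omega) mu fun r => by rw [hmu r, getD_colAdd_indiscrete_transpose]

/-- **IP Cor. 4.5, `ρ = (1⁶)`, in every square frame from its computed base** (held: Cor. 22,
"for all other `ρ`", `R_ρ = 8`, `H¹_ρ = H²_ρ = ∅`): granted the base `h = 7` (`hbase`: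
`j ∈ [6, 41]` against `7 × 7`), every `c ≥ 7` and `j ∈ [6, c² - 8]`; shapes = a new first row
over the columns `6`, `j`. [cite: IkenmeyerPanova2017, Cor. 4.5 (held: Cor. 22, "for all other ρ", p. 11)] -/
theorem ikenmeyerPanova2017_cor_4_5_fam111111
    (hbase : ∀ j, 6 ≤ j → j ≤ 41 → ∀ lam : Nat.Partition (7 * 7),
      (∀ r, lam.sortedParts.getD (r + 1) 0 = (({6, j} : Multiset ℕ).filter (r + 1 ≤ ·)).card) →
      0 < kroneckerCoeff ℂ lam (Nat.Partition.rectangle 7 7) (Nat.Partition.rectangle 7 7))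
    {c : ℕ} (hc : 7 ≤ c) {j : ℕ} (hj : 6 ≤ j) (hjR : j + 8 ≤ c * c) (lam : Nat.Partition (c * c))
    (hlam : ∀ r, lam.sortedParts.getD (r + 1) 0 =
      (({6, j} : Multiset ℕ).filter (r + 1 ≤ ·)).card) :
    0 < kroneckerCoeff ℂ lam (Nat.Partition.rectangle c c) (Nat.Partition.rectangle c c) := by
  have hcard := card_parts_indiscrete_transpose 6
  have h0 := getD_zero_indiscrete_transpose (j := 6) (by norm_num)
  refine ikenmeyerPanova2017_prop_4_3 (Nat.Partition.indiscrete 6).transpose ∅ ∅ (a := 7) (b := c) (k := j) le_rfl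
    (by rw [hcard, h0]; norm_num) (by rw [hcard]; norm_num) (by simp) (by simp) ?_ hc
    (by rw [hcard]; exact hj) (by rw [h0]; omega) (by simp) (by simp) lam
    (fun r => by rw [hlam r, getD_colAdd_indiscrete_transpose])
  intro k hk hkR _ _ mu hmu
  rw [hcard] at hk
  rw [h0] at hkR
  exact hbase k hk (by omega) mu fun r => by rw [hmu r, getD_colAdd_indiscrete_transpose]

/-- **IP Cor. 4.5 (iv), `ρ = (2,1)`, in every square frame from its computed base** (held:
Cor. 22 (iv): "When `ρ = (2,1)` and `j ≥ 2`, then we apply Proposition 4.3 with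
`H¹_ρ = H²_ρ = ∅`", `R_ρ = 6`): granted the base `h = 7` (`hbase`: `j ∈ [2, 43]` against `7 × 7`),
every `c ≥ 7` and `j ∈ [2, c² - 6]`; shapes `(c² - j - 3, 3, 2, 1^{j-2})` = a new first row over
the columns `1`, `2`, `j` (`(2,1)` rendered as the row-wise sum `(1,1) + (1)`).
[cite: IkenmeyerPanova2017, Cor. 4.5 (iv) (held: Cor. 22 (iv), p. 11)] -/
theorem ikenmeyerPanova2017_cor_4_5_fam21
    (hbase : ∀ j, 2 ≤ j → j ≤ 43 → ∀ lam : Nat.Partition (7 * 7),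
      (∀ r, lam.sortedParts.getD (r + 1) 0 =
        (({1, 2, j} : Multiset ℕ).filter (r + 1 ≤ ·)).card) →
      0 < kroneckerCoeff ℂ lam (Nat.Partition.rectangle 7 7) (Nat.Partition.rectangle 7 7))
    {c : ℕ} (hc : 7 ≤ c) {j : ℕ} (hj : 2 ≤ j) (hjR : j + 6 ≤ c * c) (lam : Nat.Partition (c * c))
    (hlam : ∀ r, lam.sortedParts.getD (r + 1) 0 =
      (({1, 2, j} : Multiset ℕ).filter (r + 1 ≤ ·)).card) :
    0 < kroneckerCoeff ℂ lam (Nat.Partition.rectangle c c) (Nat.Partition.rectangle c c) := by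
  have hcard := card_parts_twoOne
  have h0 : ((Nat.Partition.indiscrete 2).transpose.rowAdd
      (Nat.Partition.indiscrete 1)).sortedParts.getD 0 0 = 2 := by rw [getD_twoOne]; rfl
  refine ikenmeyerPanova2017_prop_4_3
    ((Nat.Partition.indiscrete 2).transpose.rowAdd (Nat.Partition.indiscrete 1)) ∅ ∅ (a := 7)
    (b := c) (k := j) le_rfl (by rw [hcard, h0]; norm_num) (by rw [hcard]; norm_num) (by simp) (by simp) ?_ hc
    (by rw [hcard]; exact hj) (by rw [h0]; omega) (by simp) (by simp) lam
    (fun r => by rw [hlam r, getD_colAdd_twoOne])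
  intro k hk hkR _ _ mu hmu
  rw [hcard] at hk
  rw [h0] at hkR
  exact hbase k hk (by omega) mu fun r => by rw [hmu r, getD_colAdd_twoOne]

end Families

/-! ### §4 Single pieces in a square frame `w × w` (column form) -/

section Atoms

/-- The rows of a single column of length `g`: `[r < g]`. [folklore] -/
theorem colRows_singleton (g r : ℕ) :
    (({g} : Multiset ℕ).filter (r + 1 ≤ ·)).card = if r < g then 1 else 0 := by
  rw [← Multiset.cons_zero g, card_filter_le_cons, Multiset.filter_zero, Multiset.card_zero, add_zero]
  split_ifs <;> omega

/-- **A good column in a square frame** (IP Cor. 4.4, proved in the tree): for `w ≥ 7` and a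
column length `g ≤ w² - 8`, `g ∉ {1, 2, 4, 6}`, the hook `(w² - g, 1^g)` — a new first row over
the single column `g` — is positive against `w × w`. [cite: IkenmeyerPanova2017, Cor. 4.4 (held: Cor. 21, p. 11)] -/
theorem exists_hook_pos_sq {w g : ℕ} (hw : 7 ≤ w) (hg : g + 8 ≤ w * w) (h1 : g ≠ 1) (h2 : g ≠ 2)
    (h4 : g ≠ 4) (h6 : g ≠ 6) :
    ∃ mu : Nat.Partition (w * w),
      (∀ r, mu.sortedParts.getD (r + 1) 0 = (({g} : Multiset ℕ).filter (r + 1 ≤ ·)).card) ∧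
        0 < kroneckerCoeff ℂ mu (Nat.Partition.rectangle w w) (Nat.Partition.rectangle w w) := by
  have hgw : g < w * w := by omega
  obtain ⟨mu, hmu⟩ := exists_parts_eq_hook (N := w * w) hgw
  refine ⟨mu, fun r => ?_, ?_⟩
  · rw [getD_sortedParts_of_parts_eq_hook hgw hmu, colRows_singleton, if_neg (Nat.succ_ne_zero r)]
    split_ifs <;> omega
  · have hsq : w * w = w ^ 2 := (sq w).symm
    refine ikenmeyerPanova2017_cor_4_4_square hw (by omega) h1 h2 h4 h6 (by omega) (by omega)
      (by omega) (by omega) mu hmu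

/-- **From the computed frame `7 × 7` to every larger square frame**: if every shape with a new
first row over the columns `A` is positive against `7 × 7`, then such a shape exists and is
positive against `w × w` for all `w ≥ 7` (IP, proof of Cor. 4.5: "we verify computationally the
statement with `h = w = 7` and then by the semigroup property deduce it for … `h, w ≥ 7`").
[cite: IkenmeyerPanova2017, Cor. 4.5 (proof, first paragraph; held: Cor. 22, p. 11)] -/
theorem exists_pos_sq_of_seven {w : ℕ} (hw : 7 ≤ w) {A : Multiset ℕ} {L : ℕ}
    (hA : ∀ x ∈ A, 1 ≤ x ∧ x ≤ L) (hA49 : A.sum + A.card ≤ 7 * 7)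
    (h7 : ∀ lam : Nat.Partition (7 * 7),
      (∀ r, lam.sortedParts.getD (r + 1) 0 = (A.filter (r + 1 ≤ ·)).card) →
      0 < kroneckerCoeff ℂ lam (Nat.Partition.rectangle 7 7) (Nat.Partition.rectangle 7 7)) :
    ∃ mu : Nat.Partition (w * w),
      (∀ r, mu.sortedParts.getD (r + 1) 0 = (A.filter (r + 1 ≤ ·)).card) ∧
        0 < kroneckerCoeff ℂ mu (Nat.Partition.rectangle w w) (Nat.Partition.rectangle w w) := by
  obtain ⟨lam, hlam⟩ := exists_partition_of_cols A hA hA49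
  exact exists_pos_of_frame_le ⟨lam, hlam, h7 lam hlam⟩ hw hw

/-- **From a statement in the frame `c × c` to a realised piece**: if every shape with a new first
row over the columns `A` (lengths in `[1, L]`, `Σ A + |A| ≤ c²`) is positive against `c × c`, then
such a shape exists and is positive there. [folklore] -/
theorem exists_pos_sq_of_forall {c : ℕ} {A : Multiset ℕ} {L : ℕ} (hA : ∀ x ∈ A, 1 ≤ x ∧ x ≤ L)
    (hAc : A.sum + A.card ≤ c * c)
    (h : ∀ lam : Nat.Partition (c * c),
      (∀ r, lam.sortedParts.getD (r + 1) 0 = (A.filter (r + 1 ≤ ·)).card) →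
      0 < kroneckerCoeff ℂ lam (Nat.Partition.rectangle c c) (Nat.Partition.rectangle c c)) :
    ∃ mu : Nat.Partition (c * c),
      (∀ r, mu.sortedParts.getD (r + 1) 0 = (A.filter (r + 1 ≤ ·)).card) ∧
        0 < kroneckerCoeff ℂ mu (Nat.Partition.rectangle c c) (Nat.Partition.rectangle c c) := by
  obtain ⟨lam, hlam⟩ := exists_partition_of_cols A hA hAc
  exact ⟨lam, hlam, h lam hlam⟩

end Atoms

/-! ### §5 Splitting a group of columns into atoms (the combinatorics of IP Lemma 4.1) -/

section Splitting

/-- **Every admissible group of columns splits into atoms.** Let `R` be any property of finite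
multisets of column lengths (in the application: "a new first row over these columns gives a
positive Kronecker coefficient against `w × w`") enjoyed by: single columns of the good lengths
`g ∉ {1, 2, 4, 6}`; all pairs and triples of bad lengths (`∈ {1, 2, 4, 6}`) other than `{1, 2}`
and `{1, 1, 2}`; the groups `{1,1,1,2}, {1,2,2,2}, {1,1,1,1,2}` (bodies `(4,1), (4,3), (5,1)`) and
`{3,4}, {3,6}, {5,6}`; and the hook families `{1,g}, {2,g}, {1,2,g}` (`g ≥ 3` good), `{4,g}`
(`g ≥ 5` good), `{6,g}` (`g ≥ 7`) of Cor. 4.5. Then every nonempty multiset of column lengths in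
`[1, L]` whose union of columns is not one of the six exceptional shapes
`𝔛 = {(1), (1,1), (1⁴), (1⁶), (2,1), (3,1)}` (as columns: `{1}, {2}, {4}, {6}, {1,2}, {1,1,2}`)
is a disjoint union of at most `|S|` groups each enjoying `R`. This is the combinatorial content of
IP Lemma 4.1 (partition decomposition) in the form needed here: IP cut `ν ∉ 𝔛` into blocks,
pairs `(k-1) × 2`, distinct good columns `ξ` and a remainder `ρ` of one of five kinds; every such
remainder is one of the groups above. [cite: IkenmeyerPanova2017, Lemma 4.1 (held: Lemma 18, pp. 9–10)] -/
theorem exists_atom_decomposition (R : Multiset ℕ → Prop) {L : ℕ}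
    (hgood : ∀ g, 1 ≤ g → g ≤ L → g ≠ 1 → g ≠ 2 → g ≠ 4 → g ≠ 6 → R {g})
    (hbad23 : ∀ A : Multiset ℕ, (∀ x ∈ A, x = 1 ∨ x = 2 ∨ x = 4 ∨ x = 6) →
      (A.card = 2 ∨ A.card = 3) → A ≠ {1, 2} → A ≠ {1, 1, 2} → R A)
    (hbad4 : R {1, 1, 1, 2} ∧ R {1, 2, 2, 2} ∧ R {1, 1, 1, 1, 2})
    (hmix : R {3, 4} ∧ R {3, 6} ∧ R {5, 6})
    (hfam1 : ∀ g, 3 ≤ g → g ≤ L → g ≠ 4 → g ≠ 6 → R {1, g})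
    (hfam2 : ∀ g, 3 ≤ g → g ≤ L → g ≠ 4 → g ≠ 6 → R {2, g})
    (hfam4 : ∀ g, 5 ≤ g → g ≤ L → g ≠ 6 → R {4, g})
    (hfam6 : ∀ g, 7 ≤ g → g ≤ L → R {6, g})
    (hfam21 : ∀ g, 3 ≤ g → g ≤ L → g ≠ 4 → g ≠ 6 → R {1, 2, g}) (n : ℕ) :
    ∀ S : Multiset ℕ, S.card = n → (∀ x ∈ S, 1 ≤ x ∧ x ≤ L) → S ≠ 0 →
      S ∉ ({{1}, {2}, {4}, {6}, {1, 2}, {1, 1, 2}} : Finset (Multiset ℕ)) →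
      ∃ G : List (Multiset ℕ), G.sum = S ∧ G.length ≤ n ∧ ∀ A ∈ G, R A := by
  induction n using Nat.strong_induction_on with
  | _ n ih =>
  intro S hn hSL hS0 hSX
  simp only [Finset.mem_insert, Finset.mem_singleton, not_or] at hSX
  obtain ⟨hX1, hX2, hX4, hX6, hX12, hX112⟩ := hSX
  have hn0 : 0 < n := by
    rw [← hn, Multiset.card_pos]; exact hS0
  -- a one-element answer
  have single : R S → ∃ G : List (Multiset ℕ), G.sum = S ∧ G.length ≤ n ∧ ∀ A ∈ G, R A :=
    fun hR => ⟨[S], by simp, by simp; omega, by simpa using hR⟩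
  by_cases hgoodex : ∃ g ∈ S, g ≠ 1 ∧ g ≠ 2 ∧ g ≠ 4 ∧ g ≠ 6
  · -- Case A: a good column `g`
    obtain ⟨g, hgS, hg1, hg2, hg4, hg6⟩ := hgoodex
    obtain ⟨hg1', hgL⟩ := hSL g hgS
    have hg3 : 3 ≤ g := by omega
    have hRg : R {g} := hgood g hg1' hgL hg1 hg2 hg4 hg6
    have pair_eq : ∀ a : ℕ, (g ::ₘ {a} : Multiset ℕ) = {a, g} := fun a => by
      ext x; simp [Multiset.count_cons, Multiset.count_singleton]; split_ifs <;> omega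
    set S' := S.erase g with hS'
    have hSeq : S = g ::ₘ S' := (Multiset.cons_erase hgS).symm
    have hcard' : S'.card = n - 1 := by rw [hS', Multiset.card_erase_of_mem hgS, hn]; rfl
    have hS'L : ∀ x ∈ S', 1 ≤ x ∧ x ≤ L := fun x hx => hSL x (Multiset.mem_of_mem_erase hx)
    by_cases hS'0 : S' = 0
    · exact single (by rw [hSeq, hS'0, Multiset.cons_zero]; exact hRg)
    by_cases hS'X : S' ∉ ({{1}, {2}, {4}, {6}, {1, 2}, {1, 1, 2}} : Finset (Multiset ℕ))
    · -- peel `{g}`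
      obtain ⟨G, hGsum, hGlen, hGR⟩ := ih (n - 1) (by omega) S' hcard' hS'L hS'0 hS'X
      refine ⟨{g} :: G, ?_, ?_, ?_⟩
      · rw [List.sum_cons, hGsum, hSeq, Multiset.singleton_add]
      · rw [List.length_cons]; omega
      · intro A hA
        rcases List.mem_cons.1 hA with rfl | hA
        · exact hRg
        · exact hGR A hA
    · -- `S ∖ {g}` is exceptional: the whole `S` is an atom (or splits as `{2,g} ⊔ {1,1}`)
      rw [not_not] at hS'X
      simp only [Finset.mem_insert, Finset.mem_singleton] at hS'X
      rcases hS'X with h | h | h | h | h | h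
      · refine single ?_
        rw [hSeq, h, pair_eq]
        exact hfam1 g hg3 hgL hg4 hg6
      · refine single ?_
        rw [hSeq, h, pair_eq]
        exact hfam2 g hg3 hgL hg4 hg6
      · refine single ?_
        rw [hSeq, h, pair_eq]
        by_cases hg5 : 5 ≤ g
        · exact hfam4 g hg5 hgL hg6
        · obtain rfl : g = 3 := by omega
          rw [Multiset.pair_comm]; exact hmix.1
      · refine single ?_
        rw [hSeq, h, pair_eq]
        by_cases hg7 : 7 ≤ g
        · exact hfam6 g hg7 hgL
        · rcases (show g = 3 ∨ g = 5 by omega) with rfl | rfl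
          · rw [Multiset.pair_comm]; exact hmix.2.1
          · rw [Multiset.pair_comm]; exact hmix.2.2
      · refine single ?_
        have : S = {1, 2, g} := by
          rw [hSeq, h]
          ext x; simp [Multiset.count_cons, Multiset.count_singleton]; split_ifs <;> omega
        rw [this]
        exact hfam21 g hg3 hgL hg4 hg6
      · -- `S = {1,1,2,g}`: the groups `{2,g}` and `{1,1}`
        refine ⟨[{2, g}, {1, 1}], ?_, ?_, ?_⟩
        · rw [hSeq, h]
          show ({2, g} : Multiset ℕ) + ({1, 1} + 0) = g ::ₘ {1, 1, 2}
          ext x; simp [Multiset.count_cons, Multiset.count_singleton]; split_ifs <;> omega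
        · have : n = 4 := by
            have hc := congrArg Multiset.card hSeq
            rw [h, hn] at hc; simpa using hc
          simp [this]
        · intro A hA
          simp only [List.mem_cons, List.mem_nil_iff, or_false] at hA
          rcases hA with rfl | rfl
          · exact hfam2 g hg3 hgL hg4 hg6
          · exact hbad23 {1, 1} (by decide) (by decide) (by decide) (by decide)
  · -- Case B: all columns are bad
    push Not at hgoodex
    have hbad : ∀ x ∈ S, x = 1 ∨ x = 2 ∨ x = 4 ∨ x = 6 := by
      intro x hx
      obtain ⟨h1x, -⟩ := hSL x hx
      by_cases e1 : x = 1; · exact Or.inl e1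
      by_cases e2 : x = 2; · exact Or.inr (Or.inl e2)
      by_cases e4 : x = 4; · exact Or.inr (Or.inr (Or.inl e4))
      exact Or.inr (Or.inr (Or.inr (hgoodex x hx e1 e2 e4)))
    -- `|S| = 1` is exceptional
    have hn1 : n ≠ 1 := by
      intro hn1
      rw [hn1, Multiset.card_eq_one] at hn
      obtain ⟨x, rfl⟩ := hn
      rcases hbad x (Multiset.mem_singleton_self x) with rfl | rfl | rfl | rfl
      · exact hX1 rfl
      · exact hX2 rfl
      · exact hX4 rfl
      · exact hX6 rfl
    -- `|S| ∈ {2, 3}`: an atom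
    by_cases hn3 : n ≤ 3
    · exact single (hbad23 S hbad (by omega) hX12 hX112)
    -- `|S| ≥ 4`
    by_cases hrep : ∃ x ∈ S, 2 ≤ S.count x
    · obtain ⟨x, hxS, hx2⟩ := hrep
      obtain ⟨U, hU⟩ := Multiset.le_iff_exists_add.1 (Multiset.le_count_iff_replicate_le.1 hx2)
      have hrep2 : Multiset.replicate 2 x = {x, x} := by
        rw [Multiset.insert_eq_cons]; rfl
      rw [hrep2] at hU
      have hUcard : U.card = n - 2 := by
        have hc := congrArg Multiset.card hU
        rw [Multiset.card_add, hn] at hc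
        simp at hc; omega
      have hUL : ∀ y ∈ U, 1 ≤ y ∧ y ≤ L := fun y hy => hSL y (by rw [hU]; exact Multiset.mem_add.2 (Or.inr hy))
      have hUbad : ∀ y ∈ U, y = 1 ∨ y = 2 ∨ y = 4 ∨ y = 6 := fun y hy =>
        hbad y (by rw [hU]; exact Multiset.mem_add.2 (Or.inr hy))
      have hU0 : U ≠ 0 := by
        intro h0; rw [h0, Multiset.card_zero] at hUcard; omega
      have hxbad := hbad x hxS
      have hRxx : R {x, x} := by
        refine hbad23 {x, x} (fun y hy => ?_) (Or.inl (by simp)) ?_ ?_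
        · have : y = x := by simpa using hy
          rw [this]; exact hxbad
        · rcases hxbad with rfl | rfl | rfl | rfl <;> decide
        · rcases hxbad with rfl | rfl | rfl | rfl <;> decide
      by_cases hUX : U ∉ ({{1}, {2}, {4}, {6}, {1, 2}, {1, 1, 2}} : Finset (Multiset ℕ))
      · -- peel the pair `{x, x}`
        obtain ⟨G, hGsum, hGlen, hGR⟩ := ih (n - 2) (by omega) U hUcard hUL hU0 hUX
        refine ⟨{x, x} :: G, ?_, ?_, ?_⟩
        · rw [List.sum_cons, hGsum, hU]
        · rw [List.length_cons]; omega
        · intro A hA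
          rcases List.mem_cons.1 hA with rfl | hA
          · exact hRxx
          · exact hGR A hA
      · rw [not_not] at hUX
        simp only [Finset.mem_insert, Finset.mem_singleton] at hUX
        -- `U` has at least two columns, so `U = {1,2}` or `U = {1,1,2}`
        have hUc2 : 2 ≤ U.card := by omega
        rcases hUX with h | h | h | h | h | h
        · rw [h] at hUc2; simp at hUc2
        · rw [h] at hUc2; simp at hUc2
        · rw [h] at hUc2; simp at hUc2
        · rw [h] at hUc2; simp at hUc2
        · -- `S = {x, x, 1, 2}`
          rw [hU, h]
          rcases hxbad with rfl | rfl | rfl | rfl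
          · exact ⟨[{1, 1, 1, 2}], by decide, by simp; omega, by simpa using hbad4.1⟩
          · exact ⟨[{1, 2, 2, 2}], by decide, by simp; omega, by simpa using hbad4.2.1⟩
          · refine ⟨[{1, 4}, {2, 4}], by decide, by simp; omega, ?_⟩
            intro A hA
            simp only [List.mem_cons, List.mem_nil_iff, or_false] at hA
            rcases hA with rfl | rfl <;> exact hbad23 _ (by decide) (by decide) (by decide) (by decide)
          · refine ⟨[{1, 6}, {2, 6}], by decide, by simp; omega, ?_⟩
            intro A hA
            simp only [List.mem_cons, List.mem_nil_iff, or_false] at hA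
            rcases hA with rfl | rfl <;> exact hbad23 _ (by decide) (by decide) (by decide) (by decide)
        · -- `S = {x, x, 1, 1, 2}`
          rw [hU, h]
          rcases hxbad with rfl | rfl | rfl | rfl
          · exact ⟨[{1, 1, 1, 1, 2}], by decide, by simp; omega, by simpa using hbad4.2.2⟩
          · refine ⟨[{1, 1}, {2, 2, 2}], by decide, by simp; omega, ?_⟩
            intro A hA
            simp only [List.mem_cons, List.mem_nil_iff, or_false] at hA
            rcases hA with rfl | rfl <;> exact hbad23 _ (by decide) (by decide) (by decide) (by decide)
          · refine ⟨[{1, 1}, {2, 4, 4}], by decide, by simp; omega, ?_⟩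
            intro A hA
            simp only [List.mem_cons, List.mem_nil_iff, or_false] at hA
            rcases hA with rfl | rfl <;> exact hbad23 _ (by decide) (by decide) (by decide) (by decide)
          · refine ⟨[{1, 1}, {2, 6, 6}], by decide, by simp; omega, ?_⟩
            intro A hA
            simp only [List.mem_cons, List.mem_nil_iff, or_false] at hA
            rcases hA with rfl | rfl <;> exact hbad23 _ (by decide) (by decide) (by decide) (by decide)
    · -- all distinct: `S = {1, 2, 4, 6}`
      push Not at hrep
      have hle : S ≤ {1, 2, 4, 6} := by
        rw [Multiset.le_iff_count]
        intro a
        by_cases ha : a ∈ S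
        · have h1 : S.count a ≤ 1 := by have := hrep a ha; omega
          refine h1.trans ?_
          rw [Nat.one_le_iff_ne_zero, Ne, Multiset.count_eq_zero, not_not]
          rcases hbad a ha with rfl | rfl | rfl | rfl <;> decide
        · rw [Multiset.count_eq_zero_of_notMem ha]; exact Nat.zero_le _
      have hS : S = {1, 2, 4, 6} :=
        Multiset.eq_of_le_of_card_le hle (by rw [hn]; simp; omega)
      rw [hS]
      refine ⟨[{1, 4}, {2, 6}], by decide, by simp; omega, ?_⟩
      intro A hA
      simp only [List.mem_cons, List.mem_nil_iff, or_false] at hA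
      rcases hA with rfl | rfl <;> exact hbad23 _ (by decide) (by decide) (by decide) (by decide)

end Splitting

/-! ### §6 The columns of a shape below its first row -/

section Columns

/-- Filtering and counting commute with finite sums of multisets. [folklore] -/
theorem card_filter_finset_sum {ι : Type*} (s : Finset ι) (m : ι → Multiset ℕ) (p : ℕ → Prop)
    [DecidablePred p] : ((∑ i ∈ s, m i).filter p).card = ∑ i ∈ s, ((m i).filter p).card := by
  classical
  induction s using Finset.induction_on with
  | empty => simp
  | insert i s hi ih => rw [Finset.sum_insert hi, Finset.sum_insert hi, Multiset.filter_add,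
      Multiset.card_add, ih]

/-- Abel summation for column counts: `Σ_{1 ≤ k ≤ L} k (f(k-1) - f(k)) + L f(L) = Σ_{r < L} f(r)`
for weakly decreasing `f`. [folklore] -/
theorem sum_Ioc_mul_sub_add (f : ℕ → ℕ) (hf : Antitone f) (L : ℕ) :
    ∑ k ∈ Finset.Ioc 0 L, k * (f (k - 1) - f k) + L * f L = ∑ r ∈ Finset.range L, f r := by
  induction L with
  | zero => simp
  | succ L ih =>
    rw [Finset.sum_Ioc_succ_top (Nat.zero_le _), Finset.sum_range_succ, ← ih, Nat.add_sub_cancel]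
    have h := hf (Nat.le_succ L)
    have key : (L + 1) * (f L - f (L + 1)) + (L + 1) * f (L + 1) = L * f L + f L := by
      rw [← Nat.mul_add, Nat.sub_add_cancel h]; ring
    omega

/-- Lists of positive naturals are determined by their zero-padded entries. [folklore] -/
theorem list_eq_of_getD_eq : ∀ (l₁ l₂ : List ℕ), (∀ x ∈ l₁, 0 < x) → (∀ x ∈ l₂, 0 < x) →
    (∀ r, l₁.getD r 0 = l₂.getD r 0) → l₁ = l₂
  | [], [], _, _, _ => rfl
  | [], y :: l₂, _, h₂, h => by
    have := h 0
    simp at this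
    have hy := h₂ y (by simp)
    omega
  | x :: l₁, [], h₁, _, h => by
    have := h 0
    simp at this
    have hx := h₁ x (by simp)
    omega
  | x :: l₁, y :: l₂, h₁, h₂, h => by
    have h0 := h 0
    simp at h0
    rw [h0, list_eq_of_getD_eq l₁ l₂ (fun z hz => h₁ z (by simp [hz])) (fun z hz => h₂ z (by simp [hz]))
      fun r => by simpa using h (r + 1)]

/-- **The body of a shape is the tail of its sorted parts**: `λ̄ = (λ₂, λ₃, …)` as a multiset.
[cite: IkenmeyerPanova2017, §1.1 (the body λ̄: "λ with its first row removed")] -/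
theorem body_eq_coe_tail {N : ℕ} (lam : Nat.Partition N) :
    body lam = (lam.sortedParts.tail : Multiset ℕ) := by
  rw [body_def, sup_parts_eq_getD_sortedParts]
  conv_lhs => rw [show lam.parts = (lam.sortedParts : Multiset ℕ) from (Multiset.sort_eq _ _).symm]
  rw [Multiset.coe_erase]
  cases h : lam.sortedParts with
  | nil => rfl
  | cons a l => simp

/-- The rows below the first are the entries of the tail of the sorted parts. [folklore] -/
theorem getD_tail_sortedParts {N : ℕ} (lam : Nat.Partition N) (r : ℕ) :
    lam.sortedParts.tail.getD r 0 = lam.sortedParts.getD (r + 1) 0 := by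
  cases h : lam.sortedParts with
  | nil => rfl
  | cons a l => rfl

/-- **The body is read off the rows below the first**: if these rows are the zero-padded entries
of a list `l` of positive naturals, then `λ̄ = l` as a multiset. [folklore] -/
theorem body_eq_coe_of_rows {N : ℕ} (lam : Nat.Partition N) (l : List ℕ) (hl : ∀ x ∈ l, 0 < x)
    (h : ∀ r, lam.sortedParts.getD (r + 1) 0 = l.getD r 0) : body lam = (l : Multiset ℕ) := by
  rw [body_eq_coe_tail]
  congr 1
  refine list_eq_of_getD_eq _ _ (fun x hx => ?_) hl fun r => by rw [getD_tail_sortedParts, h r]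
  exact lam.parts_pos ((Multiset.mem_sort _).1 (List.mem_of_mem_tail hx))

/-- **The columns of a shape below its first row.** For every partition `λ` there is a multiset
`C` of column lengths — the columns of the body `λ̄` — such that: the rows of `λ` below the first
are those of the union of the columns `C` (row `r`: `#{c ∈ C : c > r}`); every length lies in
`[1, ℓ(λ̄)]` (`ℓ(λ̄) = |body λ|` rows); `Σ C = |λ̄|` and `|C| = λ₂ ≤ |λ̄|`; and if `λ̄ ∉ 𝔛` then
`C` is none of the six column multisets `{1}, {2}, {4}, {6}, {1,2}, {1,1,2}` of the members
`(1), (1,1), (1⁴), (1⁶), (2,1), (3,1)` of `𝔛`. (IP, proof of Lemma 4.1: "Let `c_k` denote the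
number of columns of length `k - 1` in `ν`"; `c_k = ν_{k-1} - ν_k`.)
[cite: IkenmeyerPanova2017, Lemma 4.1 (proof; held: Lemma 18, p. 9)] -/
theorem exists_cols_of_shape {N : ℕ} (lam : Nat.Partition N) :
    ∃ C : Multiset ℕ,
      (∀ r, (C.filter (r + 1 ≤ ·)).card = lam.sortedParts.getD (r + 1) 0) ∧
      (∀ x ∈ C, 1 ≤ x ∧ x ≤ Multiset.card (body lam)) ∧
      C.sum = bodySize lam ∧ C.card ≤ bodySize lam ∧
      (body lam ∉ ipExceptionalBodies →
        C ∉ ({{1}, {2}, {4}, {6}, {1, 2}, {1, 1, 2}} : Finset (Multiset ℕ))) := by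
  -- the rows below the first
  set f : ℕ → ℕ := fun r => lam.sortedParts.getD (r + 1) 0 with hf
  set L := Multiset.card (body lam) with hL
  have hLc : L = lam.parts.card - 1 := card_body lam
  have hfanti : Antitone f := fun i j hij => antitone_getD_sortedParts lam (by omega)
  have hfzero : ∀ r, L ≤ r → f r = 0 := fun r hr => getD_sortedParts_eq_zero lam (by omega)
  have hfpos : ∀ r, r < L → 0 < f r := fun r hr => (getD_sortedParts_pos_iff lam (r + 1)).2 (by omega)
  -- the columns: `f(k-1) - f(k)` columns of length `k`, `1 ≤ k ≤ L`
  set C : Multiset ℕ := ∑ k ∈ Finset.Ioc 0 L, (f (k - 1) - f k) • ({k} : Multiset ℕ) with hC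
  have hmem : ∀ x ∈ C, 1 ≤ x ∧ x ≤ L := by
    intro x hx
    rw [hC, Multiset.mem_sum] at hx
    obtain ⟨k, hk, hx⟩ := hx
    rw [Multiset.mem_nsmul] at hx
    rw [Multiset.mem_singleton.1 hx.2]
    rw [Finset.mem_Ioc] at hk
    exact ⟨hk.1, hk.2⟩
  have hrows : ∀ r, (C.filter (r + 1 ≤ ·)).card = f r := by
    intro r
    rw [hC, card_filter_finset_sum]
    have e : ∀ k ∈ Finset.Ioc 0 L, (((f (k - 1) - f k) • ({k} : Multiset ℕ)).filter (r + 1 ≤ ·)).card =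
        if r + 1 ≤ k then f (k - 1) - f k else 0 := by
      intro k _
      rw [Multiset.filter_nsmul, Multiset.card_nsmul]
      by_cases hk : r + 1 ≤ k
      · rw [Multiset.filter_eq_self.2 (by simpa using hk), Multiset.card_singleton, mul_one, if_pos hk]
      · rw [Multiset.filter_eq_nil.2 (by simpa using hk), Multiset.card_zero, mul_zero, if_neg hk]
    rw [Finset.sum_congr rfl e, ← Finset.sum_filter]
    rcases le_or_gt L r with hr | hr
    · rw [hfzero r hr]
      refine Finset.sum_eq_zero fun k hk => ?_
      simp only [Finset.mem_filter, Finset.mem_Ioc] at hk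
      omega
    · have hI : (Finset.Ioc 0 L).filter (fun k => r + 1 ≤ k) = Finset.Ioc r L := by
        ext k; simp only [Finset.mem_filter, Finset.mem_Ioc]; omega
      rw [hI, sum_Ioc_sub_eq hfanti hr.le, hfzero L le_rfl, Nat.sub_zero]
  -- the size and the number of columns
  have hfirst := sup_parts_eq_getD_sortedParts lam
  have hsumrows : ∑ r ∈ Finset.range L, f r = bodySize lam := by
    have h := sum_range_getD_sortedParts_of_le lam (L := L + 1) (by omega)
    rw [Finset.sum_range_succ'] at h
    change ∑ r ∈ Finset.range L, f r + lam.sortedParts.getD 0 0 = N at h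
    rw [bodySize, hfirst]
    omega
  have hCsum : C.sum = bodySize lam := by
    rw [hC, Multiset.sum_sum]
    simp only [Multiset.sum_nsmul, Multiset.sum_singleton, smul_eq_mul]
    rw [← hsumrows, ← sum_Ioc_mul_sub_add f hfanti L, hfzero L le_rfl, mul_zero, add_zero]
    exact Finset.sum_congr rfl fun k _ => mul_comm _ _
  have hCcard : C.card = f 0 := by
    have h := hrows 0
    rwa [Multiset.filter_eq_self.2 fun x hx => by have := (hmem x hx).1; omega] at h
  have hf0 : f 0 ≤ bodySize lam := by
    rw [← hsumrows]
    rcases Nat.eq_zero_or_pos L with h0 | hLpos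
    · rw [hfzero 0 (by omega)]; exact Nat.zero_le _
    · rw [← Finset.sum_range_add_sum_Ico _ (Nat.one_le_of_lt hLpos), Finset.sum_range_one]
      exact Nat.le_add_right _ _
  refine ⟨C, hrows, hmem, hCsum, hCcard ▸ hf0, fun hX hCX => hX ?_⟩
  -- the exceptional shapes
  have rows_of : ∀ l : List ℕ, (∀ x ∈ l, 0 < x) → (∀ r, f r = l.getD r 0) → body lam = (l : Multiset ℕ) :=
    fun l hl h => body_eq_coe_of_rows lam l hl h
  rw [mem_ipExceptionalBodies_iff]
  simp only [Finset.mem_insert, Finset.mem_singleton] at hCX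
  rcases hCX with h | h | h | h | h | h
  · refine Or.inl (rows_of [1] (by decide) fun r => ?_)
    rw [← hrows r, h]
    match r with
    | 0 => decide
    | r + 1 => rw [colRows_eq_zero _ (L := 1) (by decide) (by omega)]; rfl
  · refine Or.inr (Or.inl ?_)
    rw [rows_of [1, 1] (by decide) fun r => ?_]
    · decide
    rw [← hrows r, h]
    match r with
    | 0 => decide
    | 1 => decide
    | r + 2 => rw [colRows_eq_zero _ (L := 2) (by decide) (by omega)]; rfl
  · refine Or.inr (Or.inr (Or.inl ?_))
    rw [rows_of [1, 1, 1, 1] (by decide) fun r => ?_]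
    · decide
    rw [← hrows r, h]
    match r with
    | 0 => decide
    | 1 => decide
    | 2 => decide
    | 3 => decide
    | r + 4 => rw [colRows_eq_zero _ (L := 4) (by decide) (by omega)]; rfl
  · refine Or.inr (Or.inr (Or.inr (Or.inl ?_)))
    rw [rows_of [1, 1, 1, 1, 1, 1] (by decide) fun r => ?_]
    · decide
    rw [← hrows r, h]
    match r with
    | 0 => decide
    | 1 => decide
    | 2 => decide
    | 3 => decide
    | 4 => decide
    | 5 => decide
    | r + 6 => rw [colRows_eq_zero _ (L := 6) (by decide) (by omega)]; rfl
  · refine Or.inr (Or.inr (Or.inr (Or.inr (Or.inl ?_))))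
    rw [rows_of [2, 1] (by decide) fun r => ?_]
    · decide
    rw [← hrows r, h]
    match r with
    | 0 => decide
    | 1 => decide
    | r + 2 => rw [colRows_eq_zero _ (L := 2) (by decide) (by omega)]; rfl
  · refine Or.inr (Or.inr (Or.inr (Or.inr (Or.inr ?_))))
    rw [rows_of [3, 1] (by decide) fun r => ?_]
    · decide
    rw [← hrows r, h]
    match r with
    | 0 => decide
    | 1 => decide
    | r + 2 => rw [colRows_eq_zero _ (L := 2) (by decide) (by omega)]; rfl

end Columns

/-! ### §7 Stacking atoms of a common square frame into frames with `a` rows -/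

section Stacks

/-- The rows of a union of groups of columns add up. [folklore] -/
theorem sum_map_colRows (G : List (Multiset ℕ)) (r : ℕ) :
    (G.map fun A => (A.filter (r + 1 ≤ ·)).card).sum = (G.sum.filter (r + 1 ≤ ·)).card := by
  induction G with
  | nil => simp
  | cons A G ih => rw [List.map_cons, List.sum_cons, List.sum_cons, Multiset.filter_add,
      Multiset.card_add, ih]

/-- Bookkeeping: the widths of `|G|` pieces of width `w` add up to `w |G|`. [folklore] -/
theorem sum_map_snd_const {α : Type*} (G : List α) (F : α → ℕ → ℕ) (w : ℕ) :
    ((G.map fun A => (F A, w)).map Prod.snd).sum = w * G.length := by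
  induction G with
  | nil => simp
  | cons A G ih => rw [List.map_cons, List.map_cons, List.sum_cons, ih, List.length_cons]; ring

/-- Bookkeeping: evaluating the row functions of the pieces. [folklore] -/
theorem sum_map_fst_apply {α : Type*} (G : List α) (F : α → ℕ → ℕ) (w r : ℕ) :
    ((G.map fun A => (F A, w)).map fun p => p.1 r).sum = (G.map fun A => F A r).sum := by
  induction G with
  | nil => simp
  | cons A G ih => rw [List.map_cons, List.map_cons, List.sum_cons, ih, List.map_cons, List.sum_cons]

/-- **One stack**: at most `p` pieces, each realised against `w × w`, with `wp ≤ a`, give their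
union realised against `a × w` (stack them against `w × (w·#pieces)` by the semigroup property,
transpose the rectangles and grow the rows to `a`; IP, proof of Thm. 4.6, summand (III): "by
transposition … Since … `a ≥ 2 y_k w` we have `g((k̄ × (2y_k))(aw), a × w, a × w) > 0`").
[cite: IkenmeyerPanova2017, Thm. 4.6 (proof, eq. (III); held: Thm. 23, p. 11)] -/
theorem exists_stack_pos {w a : ℕ} (G : List (Multiset ℕ)) (hGa : w * G.length ≤ a)
    (hG : ∀ A ∈ G, ∃ mu : Nat.Partition (w * w),
      (∀ r, mu.sortedParts.getD (r + 1) 0 = (A.filter (r + 1 ≤ ·)).card) ∧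
        0 < kroneckerCoeff ℂ mu (Nat.Partition.rectangle w w) (Nat.Partition.rectangle w w)) :
    ∃ mu : Nat.Partition (a * w),
      (∀ r, mu.sortedParts.getD (r + 1) 0 = (G.sum.filter (r + 1 ≤ ·)).card) ∧
        0 < kroneckerCoeff ℂ mu (Nat.Partition.rectangle a w) (Nat.Partition.rectangle a w) := by
  -- stack against `w × (w · |G|)`
  have h := exists_rowSum_pos w (G.map fun A => (fun r => (A.filter (r + 1 ≤ ·)).card, w)) ?_
  swap
  · intro q hq
    rw [List.mem_map] at hq
    obtain ⟨A, hA, rfl⟩ := hq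
    exact hG A hA
  rw [sum_map_snd_const] at h
  obtain ⟨mu, hmu, hpos⟩ := h
  -- transpose the rectangles and grow the rows
  exact exists_pos_of_frame_le' ⟨mu, fun r => by
    rw [hmu r, sum_map_fst_apply, sum_map_colRows], hpos⟩ hGa le_rfl

/-- Ceiling division bookkeeping: `⌈n/p⌉ = 1 + ⌈(n-p)/p⌉` for `n ≥ 1`, `p ≥ 1` (with
`⌈m/p⌉ = (m + p - 1)/p`). [folklore] -/
theorem ceilDiv_succ {n p : ℕ} (hp : 1 ≤ p) (hn : 1 ≤ n) :
    (n + p - 1) / p = (n - p + p - 1) / p + 1 := by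
  rcases le_or_gt n p with h | h
  · rw [Nat.sub_eq_zero_of_le h, Nat.zero_add, Nat.div_eq_of_lt (show p - 1 < p by omega),
      Nat.div_eq_of_lt_le (k := 1) (by omega) (by omega)]
  · have e : n + p - 1 = (n - p + p - 1) + p := by omega
    rw [e, Nat.add_div_right _ (by omega)]

/-- **All stacks side by side**: pieces `G`, each realised against `w × w`, `1 ≤ w ≤ a`, packed
`p = ⌊a/w⌋` to a stack, are together realised against `a × (w ⌈|G|/p⌉)` (the stacks added with
the semigroup property; IP, proof of Thm. 4.6, eq. (7): "`g((Σ_k (k̄ × 2y_k))(awℓ̄), a × (wℓ̄),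
a × (wℓ̄)) > 0`"). [cite: IkenmeyerPanova2017, Thm. 4.6 (proof, eq. (III) and (7); held: Thm. 23, pp. 11–12)] -/
theorem exists_stacks_pos {w a p : ℕ} (hp : 1 ≤ p) (hpa : w * p ≤ a) :
    ∀ (n : ℕ) (G : List (Multiset ℕ)), G.length = n →
      (∀ A ∈ G, ∃ mu : Nat.Partition (w * w),
        (∀ r, mu.sortedParts.getD (r + 1) 0 = (A.filter (r + 1 ≤ ·)).card) ∧
          0 < kroneckerCoeff ℂ mu (Nat.Partition.rectangle w w) (Nat.Partition.rectangle w w)) →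
      ∃ mu : Nat.Partition (a * (w * ((n + p - 1) / p))),
        (∀ r, mu.sortedParts.getD (r + 1) 0 = (G.sum.filter (r + 1 ≤ ·)).card) ∧
          0 < kroneckerCoeff ℂ mu (Nat.Partition.rectangle a (w * ((n + p - 1) / p)))
            (Nat.Partition.rectangle a (w * ((n + p - 1) / p))) := by
  intro n
  induction n using Nat.strong_induction_on with
  | _ n ih =>
  intro G hGn hG
  rcases Nat.eq_zero_or_pos n with rfl | hn
  · have hG0 : G = [] := List.eq_nil_of_length_eq_zero hGn
    subst hG0
    have e : a * (w * ((0 + p - 1) / p)) = 0 := by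
      rw [Nat.zero_add, Nat.div_eq_of_lt (by omega)]; simp
    refine ⟨⟨0, fun h => by simp at h, by rw [Multiset.sum_zero, e]⟩, fun r => ?_,
      kroneckerCoeff_pos_of_eq_zero e _ _ _⟩
    simp [Nat.Partition.sortedParts]
  · -- the first stack and the rest
    set G₁ := G.take p with hG₁
    set G₂ := G.drop p with hG₂
    have hG12 : G = G₁ ++ G₂ := (List.take_append_drop p G).symm
    have hlen₁ : G₁.length ≤ p := by rw [hG₁, List.length_take]; exact min_le_left _ _
    have hlen₂ : G₂.length = n - p := by rw [hG₂, List.length_drop, hGn]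
    obtain ⟨mu₁, hmu₁, hpos₁⟩ := exists_stack_pos G₁ ((Nat.mul_le_mul_left w hlen₁).trans hpa)
      fun A hA => hG A (List.mem_of_mem_take hA)
    obtain ⟨mu₂, hmu₂, hpos₂⟩ := ih (n - p) (by omega) G₂ hlen₂ fun A hA => hG A (List.mem_of_mem_drop hA)
    -- side by side
    obtain ⟨mu, hmu, hpos⟩ := exists_rowSum_pos a
      [(fun r => (G₁.sum.filter (r + 1 ≤ ·)).card, w),
        (fun r => (G₂.sum.filter (r + 1 ≤ ·)).card, w * ((n - p + p - 1) / p))]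
      (by
        intro q hq
        simp only [List.mem_cons, List.mem_nil_iff, or_false] at hq
        rcases hq with rfl | rfl
        · exact ⟨mu₁, hmu₁, hpos₁⟩
        · exact ⟨mu₂, hmu₂, hpos₂⟩)
    have e : (List.map Prod.snd [((fun r => (G₁.sum.filter (r + 1 ≤ ·)).card), w),
        ((fun r => (G₂.sum.filter (r + 1 ≤ ·)).card), w * ((n - p + p - 1) / p))]).sum =
        w * ((n + p - 1) / p) := by
      simp only [List.map_cons, List.map_nil, List.sum_cons, List.sum_nil, add_zero]
      rw [ceilDiv_succ hp hn]; ring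
    refine ⟨⟨mu.parts, mu.parts_pos, by rw [mu.parts_sum, e]⟩, fun r => ?_, ?_⟩
    · have hsp : (⟨mu.parts, mu.parts_pos, by rw [mu.parts_sum, e]⟩ :
          Nat.Partition (a * (w * ((n + p - 1) / p)))).sortedParts = mu.sortedParts :=
        sortedParts_congr_parts rfl
      rw [hsp, hmu r, hG12, List.sum_append, Multiset.filter_add, Multiset.card_add]
      simp
    · rwa [kroneckerCoeff_congr_parts (congrArg (a * ·) e) (lam := mu)
        (lam' := (⟨mu.parts, mu.parts_pos, by rw [mu.parts_sum, e]⟩ :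
          Nat.Partition (a * (w * ((n + p - 1) / p)))))
        (mu' := Nat.Partition.rectangle a (w * ((n + p - 1) / p)))
        (nu' := Nat.Partition.rectangle a (w * ((n + p - 1) / p))) rfl (by rw [e]) (by rw [e])] at hpos

end Stacks
end Literature.Computability.Complexity
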